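import Summits.ABC.IUTFork.Joshi.ATS4Eq6111ComponentSumsGenuine
import Summits.ABC.IUTFork.Joshi.ATS4Eq6811ThetaTowerSupp
import Summits.ABC.IUTFork.Joshi.ATS4Eq6811TowerGlue
import Literature.NumberTheory.NumberFields.RelativeDifferentExponentsTower
import HarnessLib

/-!
# [J-IV] (arXiv:2403.10430v2) §6.6–§6.8 / §6.11: rows (6.11.1) `Eq6111`, «component sums» `ComponentSums` and (6.8.11) `Eq6811`
# of the E5 spine close JOINTLY on ONE carrier at the genuine theta tower with `V^dst_ℚ` READ BY Lemma 6.7.1 (3)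

Proof-only bridge (0 defs) of the abc-iut cell, R-J «Joshi Y-discharge census» rows **Y-21c / Y-21e / Y-21f** (rung
LADDER-ABC:A2.RESCUE.J), seat abc-iut-E-t24 (gen 8; counted double-reader of p453374 and p456387 — this file is the INFO I2 of the
p456387 read made kernel). SOURCE: K. Joshi, *Construction of Arithmetic Teichmüller Spaces IV*, arXiv:2403.10430v2 (unrefereed; bib
`Joshi2024ATS4`): Lemma 6.7.1 p.61 l.20–30 («(1) v_ℚ ∈ V^dst_ℚ (2) v_ℚ ramifies in L′ (3) v_ℚ divides 30·ℓ or v_ℚ is in the image of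
Supp(q_{L_tpd} + d_{L_tpd}) (4) …»), (6.8.11)–(6.8.12) p.64 l.2–13, (6.11.1) p.69 l.73 – p.70 l.3, the component-sum bookkeeping
p.70 l.4–29. Page/line = the cell's render `HOME/lit/renders/Joshi-arxiv-2403.10430/`.

WHY. The three letters were derived in three files with three shapes of the free slot `V^dst_ℚ` of E-t31's carrier
`LocusVolumeDatum`: rows c/e (E-t35, `Joshi/ATS4Eq6111ComponentSumsGenuine.lean`) with `V^dst_ℚ` READ BY Lemma 6.7.1 (3) — the
`Finset` `primeFactors(30ℓ) ∪ p(Supp 𝔮_{F_tpd}) ∪ primeFactors(disc F_tpd)` —, row f (E-t31 `Joshi/ATS4Eq6811Genuine.lean`; E-t33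
`Joshi/ATS4Eq6811ThetaTower(Supp).lean`) with `V^dst_ℚ` by characterization (2) («ramifies in `L′`») or in E-t33's THREE-WAY form
((2) ∨ (3)). Passing from (3) to (2) at a prime under `Supp(𝔮_{F_tpd})` is Joshi's Lemma 6.7.1 (3) ⟹ (2) — a Tate-curve ramification
statement nobody here proves. THIS FILE shows it is not needed: the reading-(3) set satisfies E-t33's three-way hypothesis term by term
(§1: primes over `30ℓ` trivially; `Supp(𝔮_{F_tpd}) = badPlacesAvoid λ {2,ℓ}` by definition (E-t33's `residueChar_supp_mem_threeWay`); a prime dividing `disc F_tpd` lies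
under a place of `F_tpd` ramified over `ℚ` (Dedekind, tree `exists_two_le_ramificationIdx_of_dvd_discr`), hence under a place of
`K ⊇ F_tpd` ramified over `ℚ` by going-up and `e(u|p) = e(v|p)·e(u|v)`), so (§2) `Eq6811` holds for every carrier glued to the genuine
theta datum whose `V^dst_ℚ` slot IS the reading-(3) set, and (§3) rows c, e, f hold TOGETHER on one such carrier under the three
glues of the spine (`MainBoundGlue` at `MainBoundDatum.ofGenuine`, `DescentGlue`, `TowerGlue`) and the genuine readings of the
component slots — the identifications `log(d_{L′}) = log(d_K)`, `log(q) = log(𝔮_F)` being CONSEQUENCES of `MainBoundGlue` at the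
genuine datum, not extra hypotheses. Inputs: tree theorems only; FACT rows: none.

FRAMING (binding): classical algebraic number theory (Dedekind, going-up, multiplicativity of `e`) + finite bookkeeping, composed
with the cell's PROVED statements. NO side is taken on [IUTchIII] Cor. 3.12 / [IUTchIV] Thm. 1.10, on Joshi's claims or on
Mochizuki's report on them; NOT a test verdict; NOT an abc claim. Typed ≠ proved ≠ endorsed. Theorems only; standard axioms; no
`sorry`, instance, notation, `def` or new `Prop`. [claim: Joshi2024ATS4, status: disputed].
-/

noncomputable section

open Finset NumberField IsDedekindDomain
open Literature.IUT.LogVolume Literature.IUT.LogVolume.Cor22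
open Literature.NumberTheory.DiophantineGeometry Literature.NumberTheory.DiophantineGeometry.GenEll
open Literature.NumberTheory.EllipticCurves

namespace Summit.ABC.IUTFork.Joshi.ATS4

/-! ## 1. The reading-(3) set satisfies the three-way hypothesis -/

namespace GenuineVdst

/-- **Ramification goes up**: a place of `K` over a place of `F` ramified over `ℚ` is ramified over `ℚ`
(`e(u|p) = e(v|p)·e(u|v)`, `e(u|v) ≥ 1`; multiplicativity of `e` in towers = Mathlib `Ideal.ramificationIdx_tower`, here via the
tree's `ramificationIdx_int_eq_mul`). [folklore] -/
theorem two_le_ramificationIdx_of_finBelow {F K : Type*} [Field F] [NumberField F] [Field K] [NumberField K] [Algebra F K]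
    (u : HeightOneSpectrum (𝓞 K)) (h : 2 ≤ (finBelow F K u).asIdeal.ramificationIdx ℤ) :
    2 ≤ u.asIdeal.ramificationIdx ℤ := by
  rw [Literature.NumberTheory.NumberFields.ramificationIdx_int_eq_mul F K u.asIdeal]
  exact le_trans h (Nat.le_mul_of_pos_right _ (Ideal.ramificationIdx_pos u.asIdeal (𝓞 F)))

/-- **A prime dividing `disc F` lies under a place of any finite extension `K ⊇ F` ramified over `ℚ`** (Dedekind + going-up).
[cite: NeukirchANT1999, Ch. III (2.12)] -/
theorem exists_two_le_ramificationIdx_above_of_dvd_discr {F K : Type*} [Field F] [NumberField F] [Field K] [NumberField K]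
    [Algebra F K] {p : ℕ} (hp : p.Prime) (hdvd : (p : ℤ) ∣ discr F) :
    ∃ u : HeightOneSpectrum (𝓞 K), residueChar K u = p ∧ 2 ≤ u.asIdeal.ramificationIdx ℤ := by
  obtain ⟨v, hvp, hram⟩ := exists_two_le_ramificationIdx_of_dvd_discr F hp hdvd
  -- going up (Mathlib `Ideal.exists_maximal_ideal_liesOver_of_isIntegral`): a place `u` of `K` over `v`
  haveI := v.isPrime.isMaximal v.ne_bot
  obtain ⟨Q, hQmax, hQ⟩ := Ideal.exists_maximal_ideal_liesOver_of_isIntegral (S := 𝓞 K) v.asIdeal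
  have hu : finBelow F K ⟨Q, hQmax.isPrime, Ideal.ne_bot_of_liesOver_of_ne_bot v.ne_bot Q⟩ = v :=
    HeightOneSpectrum.ext hQ.over.symm
  refine ⟨⟨Q, hQmax.isPrime, Ideal.ne_bot_of_liesOver_of_ne_bot v.ne_bot Q⟩, ?_,
    two_le_ramificationIdx_of_finBelow (F := F) _ (by rw [hu]; exact hram)⟩
  have h1 := residueChar_finBelow (F := F) (K := K) ⟨Q, hQmax.isPrime, Ideal.ne_bot_of_liesOver_of_ne_bot v.ne_bot Q⟩
  rw [hu, hvp] at h1
  exact h1.symm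

/-- Every element of the reading-(3) set `primeFactors(30ℓ) ∪ p(Supp 𝔮_{F_tpd}) ∪ primeFactors(disc F_tpd)` is prime. [folklore] -/
theorem prime_of_mem_reading3 (P : NFPoint) (ℓ : ℕ) {q : ℕ}
    (hq : q ∈ (2 * 3 * 5 * ℓ).primeFactors ∪ (TateDivisorDatum.ofNFPoint P {2, ℓ}).V.image (residueChar P.F) ∪
      (discr P.F).natAbs.primeFactors) : q.Prime := by
  rcases Finset.mem_union.mp hq with hq | hq
  · rcases Finset.mem_union.mp hq with hq | hq
    · exact Nat.prime_of_mem_primeFactors hq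
    · obtain ⟨v, _, rfl⟩ := Finset.mem_image.mp hq
      exact residueChar_prime P.F v
  · exact Nat.prime_of_mem_primeFactors hq

/-- **Lemma 6.7.1 (3) ⟹ E-t33's three-way form, term by term, at the genuine theta datum**: every element of
`primeFactors(30ℓ) ∪ p(Supp 𝔮_{F_tpd}) ∪ primeFactors(disc F_tpd)` divides `2·3·5·ℓ`, or is the residue characteristic of a bad
place of `λ` away from `{2, ℓ}`, or lies under a place of `K ⊇ F_tpd` ramified over `ℚ` — NO use of Lemma 6.7.1 (3) ⟹ (2) at the
bad primes. PROVED. [claim: Joshi2024ATS4, status: disputed] -/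
theorem threeWay_of_mem_reading3 (P : NFPoint) (ℓ : ℕ) (K : Type*) [Field K] [NumberField K] [Algebra P.F K] {q : ℕ}
    (hq : q ∈ (2 * 3 * 5 * ℓ).primeFactors ∪ (TateDivisorDatum.ofNFPoint P {2, ℓ}).V.image (residueChar P.F) ∪
      (discr P.F).natAbs.primeFactors) :
    q ∣ 2 * 3 * 5 * ℓ ∨ (∃ v ∈ badPlacesAvoid P {2, ℓ}, residueChar P.F v = q) ∨
      ∃ u : HeightOneSpectrum (𝓞 K), residueChar K u = q ∧ 2 ≤ u.asIdeal.ramificationIdx ℤ := by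
  rcases Finset.mem_union.mp hq with hq | hq
  · rcases Finset.mem_union.mp hq with hq | hq
    · exact Or.inl (Nat.dvd_of_mem_primeFactors hq)
    · obtain ⟨v, hv, rfl⟩ := Finset.mem_image.mp hq
      rw [TateDivisorDatum.ofNFPoint_V_eq] at hv
      exact Or.inr (Or.inl ⟨v, hv, rfl⟩)
  · exact Or.inr (Or.inr (exists_two_le_ramificationIdx_above_of_dvd_discr (Nat.prime_of_mem_primeFactors hq)
      (Int.natCast_dvd.mpr (Nat.dvd_of_mem_primeFactors hq))))

end GenuineVdst

/-! ## 2. Row f with `V^dst_ℚ` READ BY Lemma 6.7.1 (3) -/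

section ThetaTower

variable {P : NFPoint} {F : Type} [Field F] [NumberField F] [Algebra P.F F]
  {K : Type} [Field K] [NumberField K] [Algebra F K] [Algebra P.F K] [IsScalarTower P.F F K]
  (ψ : K →ₐ[F] AlgebraicClosure F) {ℓ : ℕ}
  (Lmod : Type*) [Field Lmod] [NumberField Lmod] (h5 : 5 ≤ ℓ)
  (hq : 0 < (TateDivisorDatum.ofNFPointOver P {2, ℓ} F).logq)

/-- **Row Y-21f with `V^dst_ℚ` READ BY Lemma 6.7.1 (3)**: for `λ ∈ U_X` minimally presented, `F` a theta field, `K ⊇ F` Galois inside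
`F(E_F[ℓ])`, `ℓ ≥ 5` prime, `[L_mod:ℚ] ≥ [ℚ(j(λ)):ℚ]`, and ANY carrier `dd` glued to the genuine theta datum (`MainBoundGlue` at
`MainBoundDatum.ofGenuine`) whose `V^dst_ℚ` slot is `primeFactors(30ℓ) ∪ p(Supp 𝔮_{F_tpd}) ∪ primeFactors(disc F_tpd)` and whose
`log(s_ℚ)` slot is `Σ_{p ∈ V^dst_ℚ} log p` ((6.8.12)): `dd.Eq6811`. E-t33's `eq6811_of_thetaTowerGlue'` fed with §1. PROVED; FACT rows:
none. [claim: Joshi2024ATS4, status: disputed] -/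
theorem LocusVolumeDatum.eq6811_thetaTower_reading3 (hP : P ∈ UP) (hF : IsThetaField P F) [IsGalois F K] (hℓ : ℓ.Prime)
    (hK : letI := thetaCurve_isElliptic hP.1 F
      ((thetaCurve P F).galoisRepTorsion (ℓ : ℤ)).ker ≤ ψ.fieldRange.fixingSubgroup)
    {dd : LocusVolumeDatum}
    (G : MainBoundGlue (MainBoundDatum.ofGenuine Lmod hℓ h5 (TateDivisorDatum.ofNFPoint P {2, ℓ})
      (TateDivisorDatum.ofNFPointOver P {2, ℓ} F) (TateDivisorDatum.ofNFPointOver P {2, ℓ} K) hq) dd)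
    (hmod : Cor22.dmod P ≤ dMod Lmod)
    (hVdst : dd.Vdst = (2 * 3 * 5 * ℓ).primeFactors ∪ (TateDivisorDatum.ofNFPoint P {2, ℓ}).V.image (residueChar P.F) ∪
      (discr P.F).natAbs.primeFactors)
    (hsQ : dd.logsQ = ∑ q ∈ dd.Vdst, Real.log q) : dd.Eq6811 :=
  LocusVolumeDatum.eq6811_of_thetaTowerGlue' ψ Lmod h5 hq hP hF hℓ hK G hmod
    (fun _ hq' => GenuineVdst.prime_of_mem_reading3 P ℓ (hVdst ▸ hq'))
    (fun _ hq' => GenuineVdst.threeWay_of_mem_reading3 P ℓ K (hVdst ▸ hq')) hsQ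

/-- **The same under E-t31's `TowerGlue`** — (6.8.12) `log(s_ℚ) = Σ_{p ∈ V^dst_ℚ} log p` then holds BY DEFINITION of `logSQ`
(`TowerGlue.logsQ_eq_sum_log`, p456690). PROVED. [claim: Joshi2024ATS4, status: disputed] -/
theorem LocusVolumeDatum.eq6811_thetaTower_reading3_towerGlue (hP : P ∈ UP) (hF : IsThetaField P F) [IsGalois F K]
    (hℓ : ℓ.Prime)
    (hK : letI := thetaCurve_isElliptic hP.1 F
      ((thetaCurve P F).galoisRepTorsion (ℓ : ℤ)).ker ≤ ψ.fieldRange.fixingSubgroup)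
    {dd : LocusVolumeDatum}
    (G : MainBoundGlue (MainBoundDatum.ofGenuine Lmod hℓ h5 (TateDivisorDatum.ofNFPoint P {2, ℓ})
      (TateDivisorDatum.ofNFPointOver P {2, ℓ} F) (TateDivisorDatum.ofNFPointOver P {2, ℓ} K) hq) dd)
    (hmod : Cor22.dmod P ≤ dMod Lmod) {T : PrimeTowerDatum} (GT : PrimeTowerDatum.TowerGlue T dd)
    (hVdst : dd.Vdst = (2 * 3 * 5 * ℓ).primeFactors ∪ (TateDivisorDatum.ofNFPoint P {2, ℓ}).V.image (residueChar P.F) ∪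
      (discr P.F).natAbs.primeFactors) : dd.Eq6811 :=
  LocusVolumeDatum.eq6811_thetaTower_reading3 ψ Lmod h5 hq hP hF hℓ hK G hmod hVdst GT.logsQ_eq_sum_log

/-! ## 3. Rows c, e, f TOGETHER on one carrier at reading (3) -/

/-- **Rows Y-21c, Y-21e, Y-21f hold JOINTLY on ONE carrier of the E5 spine at the genuine theta tower with `V^dst_ℚ` READ BY
Lemma 6.7.1 (3).** Data: `λ ∈ U_X` minimally presented, `F` a theta field, `K ⊇ F` Galois inside `F(E_F[ℓ])`, `ℓ ≥ 5` prime,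
`[L_mod:ℚ] ≥ [ℚ(j(λ)):ℚ]`; a carrier `dd` under the spine's THREE glues — `MainBoundGlue` at the genuine datum
`MainBoundDatum.ofGenuine L_mod … (ofNFPoint λ {2,ℓ}) (ofNFPointOver λ {2,ℓ} F) (ofNFPointOver λ {2,ℓ} K)` (E-t30/E-t33),
`DescentGlue` to E-t4's `W`-indexed locus datum (E-t31), `TowerGlue` to E-t31's §6.7 tower (the `s`-objects) —, whose `V^dst_ℚ` slot IS
the reading-(3) set and whose component slots are read genuinely exactly as in E-t35's p456387: E-t4's places indexed into
`Supp(𝔮_F)` (`ι`), local hull log-volume at `p` := the per-`p` bundle, archimedean slot `0`, `p`-components of `log(d_{L′})` /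
`log(q)` := the (4.3.2) / (4.4.5) fibre sums at `K` / `F`. Then `dd.Eq6111 ∧ dd.ComponentSums ∧ dd.Eq6811`. The identifications
`log(d_{L′}) = log(d_K)` and `log(q) = log(𝔮_F)` that p456387 takes as hypotheses are READ OFF `MainBoundGlue` here. Composition of
p456387 (`eq6111_thetaTower`, `componentSums_thetaTower`, `hsupp_ofNFPoint_pair`), `mem_ofNFPointOver_V_iff`, and §2. PROVED; FACT
rows: none; no use of Lemma 6.7.1 (3) ⟹ (2). [claim: Joshi2024ATS4, status: disputed] -/
theorem LocusVolumeDatum.rows_cef_thetaTower_reading3 (hP : P ∈ UP) (hF : IsThetaField P F) [IsGalois F K] (hℓ : ℓ.Prime)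
    (hK : letI := thetaCurve_isElliptic hP.1 F
      ((thetaCurve P F).galoisRepTorsion (ℓ : ℤ)).ker ≤ ψ.fieldRange.fixingSubgroup)
    {dd : LocusVolumeDatum}
    (G : MainBoundGlue (MainBoundDatum.ofGenuine Lmod hℓ h5 (TateDivisorDatum.ofNFPoint P {2, ℓ})
      (TateDivisorDatum.ofNFPointOver P {2, ℓ} F) (TateDivisorDatum.ofNFPointOver P {2, ℓ} K) hq) dd)
    (hmod : Cor22.dmod P ≤ dMod Lmod)
    {lstar : ℕ} {W : Type} [Fintype W] {D : SecondMainBoundDatum lstar W} (GD : DescentGlue D dd)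
    {T : PrimeTowerDatum} (GT : PrimeTowerDatum.TowerGlue T dd)
    (hVdst : dd.Vdst = (2 * 3 * 5 * ℓ).primeFactors ∪ (TateDivisorDatum.ofNFPoint P {2, ℓ}).V.image (residueChar P.F) ∪
      (discr P.F).natAbs.primeFactors)
    (ι : W → HeightOneSpectrum (𝓞 F)) (hι : ∀ w, ι w ∈ (TateDivisorDatum.ofNFPointOver P {2, ℓ} F).V)
    (hAt : ∀ p ∈ dd.Vdst, dd.logVolAt p = ∑ w ∈ Finset.univ with residueChar F (ι w) = p, |Real.log (D.std.loc w).hullVol|)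
    (hArch : dd.logVolArch = 0)
    (DK : Finset (HeightOneSpectrum (𝓞 K))) (hDK : ∀ u, differentDivisor K (Sum.inr u) ≠ 0 → u ∈ DK)
    (hDiffAt : ∀ p ∈ dd.Vdst, dd.logDiffLpAt p =
      (Module.finrank ℚ K : ℝ)⁻¹ * ∑ u ∈ DK with residueChar K u = p, differentDivisor K (Sum.inr u) * logNorm K u)
    (hqAt : ∀ p ∈ dd.Vdst, dd.logqAt p =
      (Module.finrank ℚ F : ℝ)⁻¹ * ∑ w ∈ (TateDivisorDatum.ofNFPointOver P {2, ℓ} F).V with residueChar F w = p,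
        (TateDivisorDatum.ofNFPointOver P {2, ℓ} F).tateDivisor (Sum.inr w) * logNorm F w) :
    dd.Eq6111 ∧ dd.ComponentSums ∧ dd.Eq6811 := by
  have hVF : ∀ w ∈ (TateDivisorDatum.ofNFPointOver P {2, ℓ} F).V,
      finBelow P.F F w ∈ (TateDivisorDatum.ofNFPoint P {2, ℓ}).V :=
    fun w hw => (TateDivisorDatum.mem_ofNFPointOver_V_iff P {2, ℓ} F w).1 hw
  refine ⟨dd.eq6111_thetaTower GD (TateDivisorDatum.ofNFPointOver P {2, ℓ} F) hVF hVdst ι hι hAt hArch, ?_,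
    LocusVolumeDatum.eq6811_thetaTower_reading3_towerGlue ψ Lmod h5 hq hP hF hℓ hK G hmod GT hVdst⟩
  exact LocusVolumeDatum.componentSums_thetaTower ψ dd GT hP.1 hF hℓ hK (GenuineVdst.hsupp_ofNFPoint_pair hℓ)
    (TateDivisorDatum.ofNFPointOver P {2, ℓ} F) hVF hVdst DK hDK (by rw [G.logDiffLp_eq]; rfl) hDiffAt
    (by rw [G.logq_eq]; rfl) hqAt

end ThetaTower

/-! ## 4. The ∃-form E5 spine with rows c, e, f DISCHARGED at reading (3): SIX named inputs remain -/

/-- **p447878's ∃-form E5 spine (`abc_of_descentInputs_exists`) with rows Y-21c `Eq6111`, Y-21e `ComponentSums`, Y-21f `Eq6811`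
DISCHARGED at reading (3).** If for every `d ≥ 1`, every minimally presented `λ ∈ U(Q̄)_{≤d}` and every admissible prime `ℓ` the
supplier exhibits a theta field `F`, a Galois `K ⊇ F` inside `F(E_F[ℓ])`, «`0 < log 𝔮_F`», `L_mod` with `[ℚ(j(λ)):ℚ] ≤ [L_mod:ℚ] ≤ d`,
and ONE carrier `dd` under the spine's three glues (`MainBoundGlue` at the genuine datum, `DescentGlue` to an E-t4 locus datum `D`,
`TowerGlue` to an E-t31 tower `T`) whose `V^dst_ℚ` slot IS `primeFactors(30ℓ) ∪ p(Supp 𝔮_{F_tpd}) ∪ primeFactors(disc F_tpd)` and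
whose component slots are read genuinely (E-t4's places indexed into `Supp(𝔮_F)`, per-`p` hull bundle, archimedean slot `0`,
(4.3.2)/(4.4.5) fibre sums), together with the SIX remaining named inputs — Prop. 6.10.9 on `V^dst_ℚ` (Y-21d), Lemma 6.7.8 (Y-21g),
the LOWER BOUND (Y-21ℓ), the two Frobenius-shift equalities (Y-21h/i) and «(1/2ℓ)·log q = |log q_ℓ|» (Y-21k) — then `ABC`.
PROVED AS AN IMPLICATION (§3 + `abc_of_descentInputs_exists`); nothing of [J-III] or of the six inputs is discharged; NO abc claim;
no side taken. [claim: Joshi2024ATS4, status: disputed] -/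
theorem abc_of_descentInputs_exists_reading3
    (h : ∀ (d : ℕ), 0 < d → ∀ P ∈ UPle d, ∀ (ℓ : ℕ) (hℓ : ℓ.Prime) (h5 : 5 ≤ ℓ), IsLem587Prime d P ℓ → ITDConditions P ℓ →
      AdmitsCore P →
        ∃ (F : Type) (_ : Field F) (_ : NumberField F) (_ : Algebra P.F F)
          (K : Type) (_ : Field K) (_ : NumberField K) (_ : Algebra F K) (_ : Algebra P.F K) (_ : IsScalarTower P.F F K)
          (_ : IsGalois F K) (ψ : K →ₐ[F] AlgebraicClosure F) (hU : P.InU) (_ : IsThetaField P F)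
          (_ : letI := thetaCurve_isElliptic hU F
            ((thetaCurve P F).galoisRepTorsion (ℓ : ℤ)).ker ≤ ψ.fieldRange.fixingSubgroup)
          (hq : 0 < (TateDivisorDatum.ofNFPointOver P {2, ℓ} F).logq)
          (Lmod : Type) (_ : Field Lmod) (_ : NumberField Lmod) (_ : Cor22.dmod P ≤ dMod Lmod) (dd : LocusVolumeDatum)
          (lstar : ℕ) (W : Type) (_ : Fintype W) (D : SecondMainBoundDatum lstar W) (T : PrimeTowerDatum)
          (ι : W → HeightOneSpectrum (𝓞 F)) (DK : Finset (HeightOneSpectrum (𝓞 K))),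
          MainBoundGlue (MainBoundDatum.ofGenuine Lmod hℓ h5 (TateDivisorDatum.ofNFPoint P {2, ℓ})
            (TateDivisorDatum.ofNFPointOver P {2, ℓ} F) (TateDivisorDatum.ofNFPointOver P {2, ℓ} K) hq) dd ∧
          DescentGlue D dd ∧ PrimeTowerDatum.TowerGlue T dd ∧
          dd.Vdst = (2 * 3 * 5 * ℓ).primeFactors ∪ (TateDivisorDatum.ofNFPoint P {2, ℓ}).V.image (residueChar P.F) ∪
            (discr P.F).natAbs.primeFactors ∧
          ((∀ w, ι w ∈ (TateDivisorDatum.ofNFPointOver P {2, ℓ} F).V) ∧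
            (∀ p ∈ dd.Vdst, dd.logVolAt p =
              ∑ w ∈ Finset.univ with residueChar F (ι w) = p, |Real.log (D.std.loc w).hullVol|) ∧
            dd.logVolArch = 0 ∧
            (∀ u, differentDivisor K (Sum.inr u) ≠ 0 → u ∈ DK) ∧
            (∀ p ∈ dd.Vdst, dd.logDiffLpAt p =
              (Module.finrank ℚ K : ℝ)⁻¹ * ∑ u ∈ DK with residueChar K u = p, differentDivisor K (Sum.inr u) * logNorm K u) ∧
            (∀ p ∈ dd.Vdst, dd.logqAt p =
              (Module.finrank ℚ F : ℝ)⁻¹ * ∑ w ∈ (TateDivisorDatum.ofNFPointOver P {2, ℓ} F).V with residueChar F w = p,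
                (TateDivisorDatum.ofNFPointOver P {2, ℓ} F).tateDivisor (Sum.inr w) * logNorm F w)) ∧
          ((∀ p ∈ dd.Vdst, dd.Prop6109 p) ∧ dd.Lem678 ∧ dd.LowerBound ∧ dd.FrobShiftQ ∧ dd.FrobShiftVol ∧ dd.LogqDictionary) ∧
          dMod Lmod ≤ d) : ABC := by
  refine abc_of_descentInputs_exists fun d hd P hP ℓ hℓ h5 hℓP hITD hcore => ?_
  obtain ⟨F, _, _, _, K, _, _, _, _, _, _, ψ, hU, hF, hK, hq, Lmod, _, _, hmod, dd, lstar, W, _, D, T, ι, DK, G, GD, GT, hVdst,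
    ⟨hι, hAt, hArch, hDK, hDiffAt, hqAt⟩, ⟨h₂, h₆, h₇, h₈, h₉, hDic⟩, hdmod⟩ := h d hd P hP ℓ hℓ h5 hℓP hITD hcore
  obtain ⟨h₁, h₃, h₅⟩ := LocusVolumeDatum.rows_cef_thetaTower_reading3 ψ Lmod h5 hq hP.1 hF hℓ hK G hmod GD GT hVdst ι hι hAt
    hArch DK hDK hDiffAt hqAt
  exact ⟨F, inferInstance, inferInstance, inferInstance, K, inferInstance, inferInstance, inferInstance, inferInstance,
    inferInstance, inferInstance, ψ, hU, hF, hK, hq, Lmod, inferInstance, inferInstance, dd, G,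
    ⟨h₁, h₂, h₃, h₅, h₆, h₇, h₈, h₉, hDic⟩, hdmod⟩

end Summit.ABC.IUTFork.Joshi.ATS4

end
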